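import Literature.MathematicalPhysics.QuantumFieldTheory.Balaban1983to89.B9Eq369Product

/-!
# `Balaban1983to89.B9Eq370Expansion` — B9, pp. 404–405: the expansion of the covariant derivatives of the PRODUCT configuration
# `U′U`, `U′ = e^{iηA}`, around the background `U` — (3.70) for `D_{U′U}` and (3.74) for `D*_{U′U}` as EXACT identities, and the
# remainder of «R(U′) = exp ηiad_A = 1 + ηiad_A + ⋯» (the `F_{1,k}`-type term of ONE transport) with every `O(1)` explicit;
# kernel-checked; v1.1

CITATION HEADER (lean-in-tree rule).  Audit cell `pub-balaban`, surge node-prover lineage pv27 (B9 pp. 390–392, 396–397, 404–405),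
unit `b2b-balaban-pv27-g18` (journal CLAIM l.55412, node B9-EQ370-EXPANSION; second node of the seat, after B9-EQ369-PRODUCT =
`B9Eq369Product`, accepted p189850).  Source: T. Bałaban, *Propagators for lattice gauge theories in a background field*, Commun.
Math. Phys. **99** (1985) 389–434 [Balaban1985BackgroundPropagators] (cell paper B9; journal page = PDF page + 388), p. 404 [PDF 16],
p. 405 [PDF 17], with the dictionary (3.2)–(3.5) of p. 390–391 [PDF 2–3], quoted from the page renders
`b2b-balaban-ref1/pages/1985-cmp99-background-propagators/…-p016-x2.png`, `…-p017-x2.png` (and `…-p002/p003-x2.png`) READ AS IMAGES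
by this seat (2026-08-19; (3.70) re-read on a 2× crop).  The displays (3.1)–(3.12) are quoted in full in the headers of the lineage
leaves `B9Eq37Insertion`, `B9Eq39Adjoint`, `B9Eq310Hermitian`, the (3.69) passage in `B9Eq369Small`/`B9Eq369Product` (all imported
BY NAME, transitively, through the single import `B9Eq369Product`).

HONEST FRAMING (cell charter, verbatim in substance).  The cell audits Bałaban's papers; discharging its end statements would
make Bałaban's ultraviolet stability theorem unconditional inside this package — a constructive-QFT statement; it is NOT the
continuum limit and NOT the Clay problem.  THIS FILE DISCHARGES NOTHING of the series: it is non-commutative bookkeeping — the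
algebra of one conjugation `X ↦ e^{b}Xe^{−b}` and its Taylor tails in a Banach algebra — instantiated on the lineage's lattice
carrier (`B9Eq39Adjoint`: `R W X = WXW⁻¹`, `covD`, `covDstar`, `curl`, `divB`, the product configuration `prodCfg U η A =
(b ↦ e^{iηA(b)}·U(b))`, `fluct`; `B9Eq369Product`: `val_fluct`, `val_inv_fluct`, `prodCfg_zero`), with the exponential estimates of
the β sub-cell (`Beta.TransportVertices`: `expTail`, `norm_exp_sub_one_le_expTail`, `norm_exp_sub_one_sub_le_expTail`,
`expTail_two_le`; `Beta.BackgroundVertices`: `ad`, `norm_ad_le`, `ad_neg_left`, `expUnit`) and of b12 (`B12Membership314`: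
`exp_units_conj'`, `exp_neg_units_conj'`, `norm_mul_exp_le`, `norm_I_mul_smul`) used BY NAME.  Value = kernel certificate that the
two printed expansion formulas (3.70), (3.74) are IDENTITIES on the abstract carrier (arbitrary units `U(b)`, arbitrary bijections
as shifts, no commutativity, no `‖1‖ = 1`), with the print's second correction term of (3.70) in its TYPED reading (a located print
slip, below), and that the «remainder of the expansion R(U′) = exp ηiad_A = 1 + ηiad_A + ⋯» is, transport by transport, bounded by
`(e^{2s} − 1 − 2s)‖·‖ ≤ 2s²e^{2s}‖·‖`, `s = η|A(b)|` — the `O(1)|A|²|A′|` of (3.72) for one transport with `O(1) = 2e^{2s} ≤ 2e^{2α₁}`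
under (3.37); importable BY NAME by a successor composing (3.71)/(3.75).  NOT summit progress.

ABSOLUTE RULE.  No internally-minted statement enters as a cited fact.  Every declaration below is PROVED (tags `[folklore]`);
the `[cite: …]` tags document WHICH PRINTED DISPLAY a definition or a proved statement transcribes — the proofs are ours, the
print is not used as a hypothesis anywhere.  The only regularity input, (3.37) at ONE bond, enters `norm_covD_prodCfg_rem_le_printed`
as the HYPOTHESIS `‖A_ν(x)‖ ≤ α₁(L^jη)⁻¹` with `α₁`, `L ≥ 1`, `η > 0`, `j` as binders.

LETTERS (p. 404–405 vs p. 396).  In (3.37) (p. 396) the product configuration is written `U′U`, `U′ = e^{iηA′}`, `A′ ∈ g^c`; from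
(3.70) on (p. 404–405) the print RENAMES: the exponent field of `U′` is `A` («R(U′) = exp ηiad_A») and `A′` is the ARGUMENT bond
function the operators act on.  This file follows p. 404–405: `prodCfg U η A` (`A` = the field in the exponent), arguments `f`, `G`,
`A'`.  `D¹ := covD = η·D` and `D¹* := covDstar = η·D*_ν` (the tree's `η`-free normalisation, `B9Eq39Adjoint`; the print's `η⁻¹`
prefactors of (3.70)/(3.74) are this `η`).

WHAT IS IN PRINT («…» verbatim from the renders; [sic] marks print as printed).
* p. 404 [PDF 16], after the (3.69) passage (quoted in full in `B9Eq369Small`): «It is easy to see that for the difference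
  Δ′(U′U) − Δ′(U) we have a bound similar to (3.69), but with additional factor α₁. It is not essential in the sequal [sic]. Thus
  we have to investigate only an expansion of the operator D*_{U′U}D_{U′U}. We do it in a way similar to (3.50)–(3.53) for Δ_{U′U}.
  We have
  (D_{U′U}A′)_{νμ}(x) = (D_U A′)_{νμ}(x) + η⁻¹(exp ηiad_{A_ν(x)} − 1)(R(U(x, x + ηe_ν))A′_μ(x + ηe_ν) [sic: this «(» is never closed]
  − η⁻¹(exp ηiad_{A_ν(x)} [sic — TYPED READING `ad_{A_μ(x)}`, see PRINT SLIP] − 1)R(U(x, x + ηe_μ)A′_ν(x + ηe_μ) [sic: «R(U(» closed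
  once], (3.70)
  (D*_{U′U}D_{U′U}A′)_μ(x) = Σ_{ν=1}^d η⁻¹(R((U′U)(x, x − ηe_ν))(D_{U′U}A′)(x − ηe_ν) − (D_{U′U}A′)(x)) = (D*_U D_U A′)_μ(x)
  − η⁻¹ Σ_{ν=1}^d [ηR(U(x, x − ηe_ν))iad_{A_ν(x−ηe_ν)}(D_U A′)_{νμ}(x − ηe_ν) − R(U(x, x − ηe_ν))iad_{A_ν(x−ηe_ν)}R(U(x − ηe_ν, x))A′_μ(x)
  + R(U(x, x − ηe_ν))iad_{A_μ(x−ηe_ν)}R(U(x − ηe_ν, x − ηe_ν + ηe_μ))·A′_ν(x − ηe_ν + ηe_μ) + iad_{A_ν(x)}R(U(x, x + ηe_ν))A′_μ(x + ηe_ν)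
  − iad_{A_μ(x)}R(U(x, x + ηe_μ))A′_ν(x + ηe_μ)] − (F_{1,k}(A)A′)_μ(x) = (D*DA′)_μ(x) − Σ_{ν=1}^d [R(U(x, x − ηe_ν))iad_{A_ν(x−ηe_ν)}
  (DA′)_{νμ}(x − ηe_ν) − iad_{(D*_νA_ν)(x)}A′_μ(x) + R(U(x, x − ηe_ν))iad_{A_μ(x−ηe_ν)}(D_μA′_ν)(x − ηe_ν) + iad_{A_ν(x)}(D_νA′_μ)(x)
  − iad_{A_μ(x)}(D_μA′_ν)(x) + iad_{(D*_νA_μ)(x)}R(U(x, x − ηe_ν))A′_ν(x − ηe_ν)» — p. 405 [PDF 17]: «+ iad_{A_μ(x)}(D*_νA′_ν)(x)]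
  − (F_{1,k}(A)A′)_μ(x) = (D*DA′)_μ(x) − (V₁(A)A′)_μ(x). (3.71)  The operator F_{1,k} is defined similarly to F′_{1,k} by taking the
  remainder of the expansion R(U′) = exp ηiad_A = 1 + ηiad_A + ⋯ in the expressions above. It is a local, bounded operator
  satisfying the bound |(F_{1,k}(A)A′)_μ(x)| ≤ O(1)|A|²|A′| ≤ O(1)α₁²(L^jη)⁻²|A′|, b ∈ Ω_j (3.72) with the same norms |A|, |A′|
  determined by the set st(b) as in (3.69). The operator V₁ satisfies |(V₁(A)A′)(b)| ≤ O(1)(|A||∇A′| + |∇A||A′| + |A|²|A′|)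
  ≤ O(1)α₁((L^jη)⁻¹|∇A′| + (L^jη)⁻²|A′|), b ∈ Ω_j, (3.73) with the same conditions on norms as above. The derivatives are, of
  course, the covariant derivatives defined by U. The constant O(1) is an absolute constant depending on d only.  Next we consider
  the operator DRD*. We have discussed already the expansion (3.68) of the operator P(U′U), so we have to consider the differential
  operators again. We have (D*_{U′U}A′)(x) = (D*_U A′)(x) + Σ_{ν=1}^d η⁻¹[exp(−ηiad_{R(U(x,x−ηe_ν))A_ν(x−ηe_ν)}) − 1]
  ·R(U(x, x − ηe_ν))A′_ν(x − ηe_ν), (3.74)».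
* The dictionary used (p. 390–391 [PDF 2–3], quoted in full in `B9Eq39Adjoint`): (3.2)/(3.3) «(D^η_{U₀}A)(b) = η⁻¹(R(U₀(b))A(b₊) − A(b₋))»,
  «R(U)X = UXU⁻¹»; the UNNUMBERED display after (3.4) «(D^η_{U₀}A)(p_{μν}(x)) = (D^η_{U₀}A)_{μν}(x) = (D^η_{U₀,μ}A_ν)(x) − (D^η_{U₀,ν}A_μ)(x)»
  ((3.4) itself is the four-letter plaquette form «(D^η_{U₀}A)(p) = η⁻¹(A(x, y) + R(U₀(x, y))A(y, z) + R(U₀(x, w))A(z, w) + A(w, x))»);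
  (3.5) «U(x,x′) = U⁻¹(x′,x), A(x,x′) = −A(x′,x)
  for a bond ⟨x,x′⟩.»; p. 404, second display: «(D*_{U′U}…)(x) = Σ_{ν=1}^d η⁻¹(R((U′U)(x, x − ηe_ν))(·)(x − ηe_ν) − (·)(x))».
PRINT SLIP, LOCATED (DIVERGENCE D-pv27.8).  By the component formula after (3.4), `(D A′)_{νμ} = D_νA′_μ − D_μA′_ν`, and `(U′U)(x, x + ηe_μ) = e^{iηA_μ(x)}U(x, x + ηe_μ)`,
so the second correction term of (3.70) — the one carrying `R(U(x, x + ηe_μ))A′_ν(x + ηe_μ)` — conjugates by `exp ηiad_{A_μ(x)}`, not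
by `exp ηiad_{A_ν(x)}` as printed; the print's OWN first-order term in (3.71), «− iad_{A_μ(x)}R(U(x, x + ηe_μ))A′_ν(x + ηe_μ)», confirms
the typed reading.  `curl_prodCfg` below is (3.70) in this reading and is an IDENTITY (so the printed subscript cannot be right
unless `μ = ν`, where both sides vanish).  Two parentheses of (3.70) are unbalanced as printed (marked above); immaterial.

WHAT THIS FILE PROVES.  MODEL (as in the lineage leaves): `𝔸` a complete normed ℂ-algebra (no commutativity, no `‖1‖ = 1`, no
unitarity); sites `S`, directions `ι` (a `Fintype` only where `D* = Σ_ν D*_ν` occurs), shifts `T μ : S ≃ S` (bijections; NO commutation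
assumed; `x + e_μ = T μ x`, `x − e_μ = (T μ).symm x`), background `U : ι → S → 𝔸ˣ` (ARBITRARY units), exponent field `A : ι → S → 𝔸`,
`U′_ν(x) = fluct η A ν x = e^{iηA_ν(x)}` (as a unit), `(U′U)_ν(x) = prodCfg U η A ν x = e^{iηA_ν(x)}U_ν(x)`; norms = the `NormedRing` norm.
* §1 ONE CONJUGATION `R(e^{b})X = e^{b}Xe^{−b}` (abstract `b X : 𝔸`): `conj_sub_eq` (zeroth order, exactly: `(e^{b} − 1)Xe^{−b} + X(e^{−b} − 1)`);
  **`norm_conj_sub_le`** `‖e^{b}Xe^{−b} − X‖ ≤ (e^{2‖b‖} − 1)‖X‖`, `norm_conj_sub_le_lin` (`≤ 2‖b‖e^{2‖b‖}‖X‖`); the REMAINDER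
  `conjRem b X = e^{b}Xe^{−b} − X − [b, X]` («taking the remainder of the expansion R(U′) = exp ηiad_A = 1 + ηiad_A + ⋯»; `[b, X] = ad b X`
  of `Beta.BackgroundVertices`), `conj_eq_expand` (`e^{b}Xe^{−b} = X + [b,X] + 𝓕(b,X)`), `conjRem_eq` (exactly, as three Taylor tails:
  `X(e^{−b} − 1 + b) + bX(e^{−b} − 1) + (e^{b} − 1 − b)Xe^{−b}`); **`norm_conjRem_le`** `‖𝓕(b,X)‖ ≤ (e^{2‖b‖} − 1 − 2‖b‖)‖X‖` and
  **`norm_conjRem_le_sq`** `≤ 2‖b‖²e^{2‖b‖}‖X‖` (real tails: `e^{x} − 1 ≤ xe^{x}` = the tree's `AreaLaw.exp_sub_one_le_mul_exp`,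
  re-derived inline, and `exp_sub_one_sub_le_sq_mul_exp` `e^{x} − 1 − x ≤ ½x²e^{x}` = `expTail_two_le` unfolded; the Banach tails
  `‖e^{±b} − 1‖ ≤ e^{‖b‖} − 1`, `‖e^{b} − 1 − b‖`, `‖e^{−b} − 1 + b‖ ≤ e^{‖b‖} − 1 − ‖b‖` come from `Beta.TransportVertices` BY NAME — their
  unfolded `ℝ`-forms `Literature.Analysis.Calculus.norm_exp_sub_one_le`, `OneLinkLaplace.norm_exp_sub_one_sub_le` are landed elsewhere
  and NOT restated); `norm_R_le` (`‖R(V)Z‖ ≤ ‖V‖‖Z‖‖V⁻¹‖`);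
  **`R_conj_exp`** `R(V)(e^{−b}Ze^{b}) = e^{−R(V)b}·R(V)Z·e^{R(V)b}` (conjugation by a unit commutes with `exp`: the transport that
  produces the subscript `R(U(x,x−ηe_ν))A_ν(x−ηe_ν)` of (3.74)).
* §2 **(3.70).**  `R_fluct` (`R(U′_ν(x))X = e^{iηA_ν(x)}Xe^{−iηA_ν(x)}` — the print's `exp ηiad_{A_ν(x)}` APPLIED, see NOT PROVED);
  **`covD_prodCfg`** — (3.70) for one covariant derivative, exactly: `(D¹_{U′U,ν}f)(x) = (D¹_{U,ν}f)(x) + (R(U′_ν(x)) − 1)R(U_ν(x))f(x+e_ν)`;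
  **`curl_prodCfg`** — (3.70) for the curl (display after (3.4)), exactly, in the typed reading; **`covD_prodCfg_expand`** — to first order:
  `= (D¹_{U,ν}f)(x) + iη[A_ν(x), Y] + 𝓕(iηA_ν(x), Y)`, `Y = R(U_ν(x))f(x+e_ν)`; in norm: `norm_covD_prodCfg_sub_le` (zeroth order,
  `≤ (e^{2η‖A_ν(x)‖} − 1)‖Y‖`), `norm_vertex_le` (`‖iη[A_ν(x),Y]‖ ≤ 2η‖A_ν(x)‖‖Y‖`), **`norm_covD_prodCfg_rem_le`** (the one-transport
  `F`-remainder `≤ 2(η‖A_ν(x)‖)²e^{2η‖A_ν(x)‖}‖Y‖`), **`norm_covD_prodCfg_rem_le_printed`** ((3.37) at the bond, `L ≥ 1`, `η > 0`: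
  `≤ 2e^{2α₁}·α₁²·(L^{−j})²·‖Y‖`, i.e. `η·2e^{2α₁}·α₁²(L^jη)⁻²‖Y‖` — the shape `O(1)α₁²(L^jη)⁻²|A′|` of (3.72) for ONE transport, one
  power of `η` to spare for the outer difference quotient of (3.71)); `norm_Iη_smul` (`‖iηX‖ = η‖X‖`).
* §3 **(3.74).**  `R_inv_prodCfg` (the reversed product bond through (3.5): `R((U′U)_ν(y)⁻¹)Z = R(U_ν(y)⁻¹)(e^{−iηA_ν(y)}Ze^{iηA_ν(y)})`);
  **`covDstar_prodCfg`** — (3.74) for one direction, exactly: `(D¹*_{U′U,ν}G)(x) = (D¹*_{U,ν}G)(x) + (e^{−a}We^{a} − W)`,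
  `a = R(U(x,x−e_ν))(iηA_ν(x−e_ν))`, `W = R(U(x,x−e_ν))G(x−e_ν)`, `U(x,x−e_ν) = U_ν(x−e_ν)⁻¹`; **`divB_prodCfg`** — (3.74) for
  `D* = Σ_ν D*_ν` on bond functions (`B9Eq39Adjoint.divB`), exactly; `R_Iη_smul` (`R(V)(iηX) = iηR(V)X`: the transported exponent keeps
  its `iη`); in norm: `norm_covDstar_prodCfg_sub_le` (zeroth order, `≤ (e^{2η‖a′‖} − 1)‖W‖`, `a′ = R(U(x,x−e_ν))A_ν(x−e_ν)`),
  **`covDstar_prodCfg_expand`** (first order: `− iη[a′, W] + 𝓕(−iηa′, W)`, the print's `exp(−ηiad_{a′}) = 1 − ηiad_{a′} + ⋯`) and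
  **`norm_covDstar_prodCfg_rem_le`** (`‖𝓕‖ ≤ 2(η‖a′‖)²e^{2η‖a′‖}‖W‖`; `‖a′‖ ≤ ‖U_ν(y)⁻¹‖‖A_ν(y)‖‖U_ν(y)‖` by `norm_R_le`, `= ‖A_ν(y)‖`-sized
  for a `G`-valued background in an operator norm).
* §4 SANITY (`example`s): `A = 0 ⟹ D_{U′U} = D_U`; `𝓕(0, X) = 0`; `[b, X] = 0 ⟹ e^{b}Xe^{−b} = X` (the corrections are genuinely
  non-abelian).

RELATED IN THE TREE, NOT DUPLICATED (searched 2026-08-19: MODULE-MAP rows B9/B12/Beta; `grep -rn "(3.70)\|(3.74)\|(3.71)\|exp ηiad" Balaban1983to89/`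
— the only hits are the NOT-PROVED lists of `B9Eq369Small`/`B9Eq369Product`): `Beta.BackgroundVertices` (β sub-cell) = the Taylor
JETS in `t` at `t = 0` of `covD` along the one-parameter backgrounds `exp(tηA)` at the UNIT background (`conjExp`, `covDexp`,
`hasDerivAt_conjExp`: derivative = `ad`; second jets `K₂form`; the mesh cancels) — an infinitesimal statement; the present file is the
INTEGRATED form with NORM REMAINDERS at an ARBITRARY background `U` for the product `U′U`, and uses only its `ad`/`norm_ad_le`/`expUnit`
BY NAME; `Beta.TransportVertices` = the scalar/Banach Taylor tails `expTail` (used BY NAME); `B12Membership314` (b12) = conjugation of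
`exp` by units and plaquette-word norm expansions (used BY NAME); `B9Eq39Adjoint` (this lineage) = the carrier and (3.8)–(3.12);
`B9Eq369Product` = the plaquette word of `U′U` and (3.69) for `Δ′(U′U)`.  Nothing in the tree states (3.70) or (3.74), or bounds the
conjugation remainder `e^{b}Xe^{−b} − X − [b,X]` in norm.

NOT PROVED HERE, NOT CLAIMED: (3.71) — the composition `D*_{U′U}D_{U′U} = D*_U D_U − V₁(A) − F_{1,k}(A)` with the printed
first-order operator `V₁` written out (eight `iad` terms, incl. the `iad_{(D*_νA_ν)(x)}`/`iad_{(D*_νA_μ)(x)}` regrouping of p. 404–405)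
and (3.72)/(3.73) at the `D*D` level with the sup norms over `st(b)` — this file supplies the per-transport identities and remainder
bounds such a composition consumes, not the composition; (3.75), (3.76) (`DRD*`, `V₂`, `F_{2,k}`, `P₁`) likewise; the identification
of the conjugation `R(e^{iηA})` with the operator exponential `exp(ηi ad_A)` as a power series in `ad_A` (the print's notation; here
`exp ηiad_{A}` is TYPED as the conjugation `X ↦ e^{iηA}Xe^{−iηA}`, which the print itself equates: «R(U′) = exp ηiad_A», and the
«remainder … = 1 + ηiad_A + ⋯» is typed as `conjRem` — the identity `Ad∘exp = exp∘ad` is not formalised and not needed for the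
bounds); the sentence on `Δ′(U′U) − Δ′(U)` («additional factor α₁ … not essential»); the domain geometry (`Ω_j`, `st(b)`, `b ∈ Ω_j`):
(3.37) enters at ONE bond as a hypothesis with the scale-`j` constants as binders; any statement in the normalised Hilbert–Schmidt
norm of p. 392 (cell DIVERGENCE D-1: all bounds are in the abstract `NormedRing` norm).  Records: GAPS C-pv27-72, DIVERGENCE D-pv27.8.
NOT summit progress.

REVISION v1.1 (2026-08-19, same seat, minutes after v1 = p190151, commit 6229dc621558): LOCATOR ONLY — the component formula
`(D A)_{μν} = D_μA_ν − D_νA_μ` is the UNNUMBERED display after (3.4) on p. 391 ((3.4) is the four-letter plaquette form; the same slip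
as DOCFIX D1 of adv9-g57 on `B9Eq369Product`, journal l.55379); four locator labels corrected.  No declaration, statement or proof changed.
-/

namespace Literature.MathematicalPhysics.QuantumFieldTheory.Balaban1983to89.B9Eq370Expansion

open NormedSpace Complex
open Literature.MathematicalPhysics.QuantumFieldTheory.Balaban1983to89
open Literature.MathematicalPhysics.QuantumFieldTheory.Balaban1983to89.Beta.TransportVertices
open Literature.MathematicalPhysics.QuantumFieldTheory.Balaban1983to89.Beta.BackgroundVertices (ad norm_ad_le)
open Literature.MathematicalPhysics.QuantumFieldTheory.Balaban1983to89.B9Eq37Insertion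
open Literature.MathematicalPhysics.QuantumFieldTheory.Balaban1983to89.B9Eq39Adjoint
open Literature.MathematicalPhysics.QuantumFieldTheory.Balaban1983to89.B9Eq369Product

/-! ## §1  The remainder of the expansion `R(U′) = exp ηi ad_A = 1 + ηi ad_A + ⋯` (p. 405) -/

section Conjugation

variable {𝔸 : Type*} [NormedRing 𝔸] [NormedAlgebra ℂ 𝔸] [CompleteSpace 𝔸]

omit [NormedAlgebra ℂ 𝔸] [CompleteSpace 𝔸] in
/-- ZEROTH ORDER, exactly: `e^{b}Xe^{−b} − X = (e^{b} − 1)Xe^{−b} + X(e^{−b} − 1)`. [folklore] -/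
theorem conj_sub_eq (b X : 𝔸) :
    exp b * X * exp (-b) - X = (exp b - 1) * X * exp (-b) + X * (exp (-b) - 1) := by
  noncomm_ring

/-- `‖e^{−b} − 1‖ ≤ e^{‖b‖} − 1` (`Beta.TransportVertices.norm_exp_sub_one_le_expTail` at `−b`; the `+b` form unfolded over `ℝ` is
the tree's `Literature.Analysis.Calculus.norm_exp_sub_one_le`, used below through `expTail` and not restated). [folklore] -/
theorem norm_exp_neg_sub_one_le' (b : 𝔸) : ‖exp (-b) - 1‖ ≤ Real.exp ‖b‖ - 1 := by
  simpa using norm_exp_sub_one_le_expTail ℂ (-b)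

/-- `‖e^{−b} − 1 + b‖ ≤ e^{‖b‖} − 1 − ‖b‖` (`norm_exp_sub_one_sub_le_expTail` at `−b`; the `+b` form is the tree's
`OneLinkLaplace.norm_exp_sub_one_sub_le`, used below through `expTail` and not restated). [folklore] -/
theorem norm_exp_neg_sub_one_add_le (b : 𝔸) : ‖exp (-b) - 1 + b‖ ≤ Real.exp ‖b‖ - 1 - ‖b‖ := by
  have h := norm_exp_sub_one_sub_le_expTail ℂ (-b)
  simpa [sub_neg_eq_add] using h

/-- **ZEROTH-ORDER REMAINDER** of `R(e^{b}) = 1 + ⋯`: `‖e^{b}Xe^{−b} − X‖ ≤ (e^{2‖b‖} − 1)‖X‖` (no `‖1‖ = 1`, no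
commutativity). [folklore] [cite: Balaban1985BackgroundPropagators, p.405] -/
theorem norm_conj_sub_le (b X : 𝔸) : ‖exp b * X * exp (-b) - X‖ ≤ (Real.exp (2 * ‖b‖) - 1) * ‖X‖ := by
  have hE : 0 ≤ Real.exp ‖b‖ - 1 := by linarith [Real.add_one_le_exp ‖b‖, norm_nonneg b]
  have t1 : ‖(exp b - 1) * X * exp (-b)‖ ≤ (Real.exp ‖b‖ - 1) * ‖X‖ * Real.exp ‖b‖ := by
    calc ‖(exp b - 1) * X * exp (-b)‖ ≤ ‖(exp b - 1) * X‖ * Real.exp ‖-b‖ :=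
          B12Membership314.norm_mul_exp_le _ _
      _ ≤ ‖exp b - 1‖ * ‖X‖ * Real.exp ‖b‖ := by
          rw [norm_neg]; gcongr; exact norm_mul_le _ _
      _ ≤ (Real.exp ‖b‖ - 1) * ‖X‖ * Real.exp ‖b‖ := by
          gcongr; simpa using norm_exp_sub_one_le_expTail ℂ b
  have t2 : ‖X * (exp (-b) - 1)‖ ≤ ‖X‖ * (Real.exp ‖b‖ - 1) :=
    (norm_mul_le _ _).trans (by gcongr; exact norm_exp_neg_sub_one_le' b)
  calc ‖exp b * X * exp (-b) - X‖ = ‖(exp b - 1) * X * exp (-b) + X * (exp (-b) - 1)‖ := by rw [conj_sub_eq]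
    _ ≤ ‖(exp b - 1) * X * exp (-b)‖ + ‖X * (exp (-b) - 1)‖ := norm_add_le _ _
    _ ≤ (Real.exp ‖b‖ - 1) * ‖X‖ * Real.exp ‖b‖ + ‖X‖ * (Real.exp ‖b‖ - 1) := add_le_add t1 t2
    _ = (Real.exp (2 * ‖b‖) - 1) * ‖X‖ := by
          rw [show 2 * ‖b‖ = ‖b‖ + ‖b‖ by ring, Real.exp_add]; ring

/-- The remainder of `R(e^{b}) = exp ad_b = 1 + ad_b + ⋯` after the first-order term:
`𝓕(b, X) = e^{b}Xe^{−b} − X − [b, X]` («the remainder of the expansion R(U′) = exp ηiad_A = 1 + ηiad_A + ⋯», p. 405;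
`ad b X = bX − Xb` is `Beta.BackgroundVertices.ad` BY NAME). [folklore] [cite: Balaban1985BackgroundPropagators, p.405] -/
noncomputable def conjRem (b X : 𝔸) : 𝔸 := exp b * X * exp (-b) - X - ad b X

omit [NormedAlgebra ℂ 𝔸] [CompleteSpace 𝔸] in
/-- The expansion to first order: `e^{b}Xe^{−b} = X + [b, X] + 𝓕(b, X)`. [folklore] -/
theorem conj_eq_expand (b X : 𝔸) : exp b * X * exp (-b) = X + ad b X + conjRem b X := by
  simp only [conjRem]; abel

omit [NormedAlgebra ℂ 𝔸] [CompleteSpace 𝔸] in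
/-- FIRST ORDER, exactly — three Taylor tails: `𝓕(b, X) = X(e^{−b} − 1 + b) + bX(e^{−b} − 1) + (e^{b} − 1 − b)Xe^{−b}`.
[folklore] -/
theorem conjRem_eq (b X : 𝔸) :
    conjRem b X = X * (exp (-b) - 1 + b) + b * X * (exp (-b) - 1) + (exp b - 1 - b) * X * exp (-b) := by
  simp only [conjRem, ad]
  noncomm_ring

/-- **FIRST-ORDER REMAINDER**: `‖𝓕(b, X)‖ ≤ (e^{2‖b‖} − 1 − 2‖b‖)‖X‖`. [folklore] [cite: Balaban1985BackgroundPropagators, p.405] -/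
theorem norm_conjRem_le (b X : 𝔸) : ‖conjRem b X‖ ≤ (Real.exp (2 * ‖b‖) - 1 - 2 * ‖b‖) * ‖X‖ := by
  have hE : 0 ≤ Real.exp ‖b‖ - 1 := by linarith [Real.add_one_le_exp ‖b‖, norm_nonneg b]
  have hT : ‖exp b - 1 - b‖ ≤ Real.exp ‖b‖ - 1 - ‖b‖ := by simpa using norm_exp_sub_one_sub_le_expTail ℂ b
  have hE2 : 0 ≤ Real.exp ‖b‖ - 1 - ‖b‖ := (norm_nonneg _).trans hT
  have t1 : ‖X * (exp (-b) - 1 + b)‖ ≤ ‖X‖ * (Real.exp ‖b‖ - 1 - ‖b‖) :=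
    (norm_mul_le _ _).trans (by gcongr; exact norm_exp_neg_sub_one_add_le b)
  have t2 : ‖b * X * (exp (-b) - 1)‖ ≤ ‖b‖ * ‖X‖ * (Real.exp ‖b‖ - 1) := by
    calc ‖b * X * (exp (-b) - 1)‖ ≤ ‖b * X‖ * ‖exp (-b) - 1‖ := norm_mul_le _ _
      _ ≤ ‖b‖ * ‖X‖ * (Real.exp ‖b‖ - 1) := by
          gcongr
          · exact norm_mul_le _ _
          · exact norm_exp_neg_sub_one_le' b
  have t3 : ‖(exp b - 1 - b) * X * exp (-b)‖ ≤ (Real.exp ‖b‖ - 1 - ‖b‖) * ‖X‖ * Real.exp ‖b‖ := by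
    calc ‖(exp b - 1 - b) * X * exp (-b)‖ ≤ ‖(exp b - 1 - b) * X‖ * Real.exp ‖-b‖ :=
          B12Membership314.norm_mul_exp_le _ _
      _ ≤ ‖exp b - 1 - b‖ * ‖X‖ * Real.exp ‖b‖ := by
          rw [norm_neg]; gcongr; exact norm_mul_le _ _
      _ ≤ (Real.exp ‖b‖ - 1 - ‖b‖) * ‖X‖ * Real.exp ‖b‖ := by gcongr
  calc ‖conjRem b X‖
      = ‖X * (exp (-b) - 1 + b) + b * X * (exp (-b) - 1) + (exp b - 1 - b) * X * exp (-b)‖ := by rw [conjRem_eq]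
    _ ≤ ‖X * (exp (-b) - 1 + b)‖ + ‖b * X * (exp (-b) - 1)‖ + ‖(exp b - 1 - b) * X * exp (-b)‖ :=
          norm_add₃_le
    _ ≤ ‖X‖ * (Real.exp ‖b‖ - 1 - ‖b‖) + ‖b‖ * ‖X‖ * (Real.exp ‖b‖ - 1)
          + (Real.exp ‖b‖ - 1 - ‖b‖) * ‖X‖ * Real.exp ‖b‖ := add_le_add_three t1 t2 t3
    _ = (Real.exp (2 * ‖b‖) - 1 - 2 * ‖b‖) * ‖X‖ := by
          rw [show 2 * ‖b‖ = ‖b‖ + ‖b‖ by ring, Real.exp_add]; ring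

/-- `e^{x} − 1 − x ≤ ½x²e^{x}` for `x ≥ 0` (`Beta.TransportVertices.expTail_two_le` BY NAME). [folklore] -/
theorem exp_sub_one_sub_le_sq_mul_exp {x : ℝ} (hx : 0 ≤ x) : Real.exp x - 1 - x ≤ x ^ 2 / 2 * Real.exp x := by
  have h := expTail_two_le hx
  rwa [expTail_two] at h

/-- Polynomial form of the zeroth-order remainder: `‖e^{b}Xe^{−b} − X‖ ≤ 2‖b‖e^{2‖b‖}‖X‖` — «O(1)|A||A′|». [folklore]
[cite: Balaban1985BackgroundPropagators, p.405] -/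
theorem norm_conj_sub_le_lin (b X : 𝔸) :
    ‖exp b * X * exp (-b) - X‖ ≤ 2 * ‖b‖ * Real.exp (2 * ‖b‖) * ‖X‖ := by
  -- `e^{x} − 1 ≤ xe^{x}` (all real `x`, from `1 − x ≤ e^{−x}`): the tree's `AreaLaw.exp_sub_one_le_mul_exp`
  -- (`Sweep1AreaLawProofs`, not imported into this lineage; re-derived in two lines, not restated).
  have hx : ∀ x : ℝ, Real.exp x - 1 ≤ x * Real.exp x := fun x => by
    have h := Real.add_one_le_exp (-x)
    have hx' : Real.exp (-x) * Real.exp x = 1 := by rw [← Real.exp_add, neg_add_cancel, Real.exp_zero]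
    nlinarith [Real.exp_pos x, Real.exp_pos (-x)]
  exact (norm_conj_sub_le b X).trans (mul_le_mul_of_nonneg_right (hx _) (norm_nonneg _))

/-- Polynomial form of the first-order remainder: `‖𝓕(b, X)‖ ≤ 2‖b‖²e^{2‖b‖}‖X‖` — the «O(1)|A|²|A′|» of (3.72) for ONE
transport, with `O(1) = 2e^{2‖b‖}`. [folklore] [cite: Balaban1985BackgroundPropagators, (3.72) p.405] -/
theorem norm_conjRem_le_sq (b X : 𝔸) : ‖conjRem b X‖ ≤ 2 * ‖b‖ ^ 2 * Real.exp (2 * ‖b‖) * ‖X‖ := by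
  refine (norm_conjRem_le b X).trans (mul_le_mul_of_nonneg_right ?_ (norm_nonneg _))
  have h := exp_sub_one_sub_le_sq_mul_exp (show (0 : ℝ) ≤ 2 * ‖b‖ by positivity)
  calc Real.exp (2 * ‖b‖) - 1 - 2 * ‖b‖ ≤ (2 * ‖b‖) ^ 2 / 2 * Real.exp (2 * ‖b‖) := h
    _ = 2 * ‖b‖ ^ 2 * Real.exp (2 * ‖b‖) := by ring

omit [NormedAlgebra ℂ 𝔸] [CompleteSpace 𝔸] in
/-- Conjugation by a unit is bounded by the transport size: `‖R(V)Z‖ ≤ ‖V‖‖Z‖‖V⁻¹‖`. [folklore] -/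
theorem norm_R_le (V : 𝔸ˣ) (Z : 𝔸) : ‖R V Z‖ ≤ ‖(V : 𝔸)‖ * ‖Z‖ * ‖((V⁻¹ : 𝔸ˣ) : 𝔸)‖ := by
  rw [R_def]
  exact (norm_mul_le _ _).trans (mul_le_mul_of_nonneg_right (norm_mul_le _ _) (norm_nonneg _))

omit [NormedAlgebra ℂ 𝔸] [CompleteSpace 𝔸] in
/-- `R(V)` TRANSPORTS A CONJUGATION: `R(V)(e^{−b}Ze^{b}) = e^{−R(V)b}·R(V)Z·e^{R(V)b}` (`B12Membership314.exp_units_conj'` BY NAME: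
conjugation by a unit commutes with `exp`). [folklore] [cite: Balaban1985BackgroundPropagators, (3.74) p.405] -/
theorem R_conj_exp {𝔸 : Type*} [NormedRing 𝔸] [NormedAlgebra ℂ 𝔸] [CompleteSpace 𝔸] (V : 𝔸ˣ) (b Z : 𝔸) :
    R V (exp (-b) * Z * exp b) = exp (-(R V b)) * R V Z * exp (R V b) := by
  rw [R_def, R_def, R_def, B12Membership314.exp_units_conj', B12Membership314.exp_neg_units_conj']
  simp only [mul_assoc, Units.inv_mul_cancel_left]

end Conjugation

/-! ## §2  (3.70): the covariant derivative of the product configuration -/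

section Eq370

variable {𝔸 : Type*} [NormedRing 𝔸] [NormedAlgebra ℂ 𝔸] [CompleteSpace 𝔸] {S : Type*} {ι : Type*}
variable (T : ι → Equiv.Perm S) (U : ι → S → 𝔸ˣ)

/-- `R(U′(b))X = e^{iηA(b)}·X·e^{−iηA(b)}` — the print's `exp ηi ad_{A(b)}` applied to `X` (p. 405 «R(U′) = exp ηiad_A»).
[folklore] [cite: Balaban1985BackgroundPropagators, p.405] -/
theorem R_fluct (η : ℝ) (A : ι → S → 𝔸) (μ : ι) (x : S) (X : 𝔸) :
    R (fluct η A μ x) X = exp (((I * η : ℂ)) • A μ x) * X * exp (-(((I * η : ℂ)) • A μ x)) := by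
  rw [R_def, val_fluct, val_inv_fluct]

/-- **(3.70) FOR ONE COVARIANT DERIVATIVE**, exactly: with `Y = R(U(x, x+e_ν))f(x+e_ν)`,
`(D¹_{U′U,ν}f)(x) = (D¹_{U,ν}f)(x) + (R(U′_ν(x)) − 1)Y` — the print's
`(D_{U′U}·)_ν = (D_U·)_ν + η⁻¹(exp ηiad_{A_ν(x)} − 1)R(U(x, x+ηe_ν))(·)(x+ηe_ν)` at `η`-free normalisation (`D¹ = ηD`).
[folklore] [cite: Balaban1985BackgroundPropagators, (3.70) p.404] -/
theorem covD_prodCfg (η : ℝ) (A : ι → S → 𝔸) (ν : ι) (f : S → 𝔸) (x : S) :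
    covD T (prodCfg U η A) ν f x
      = covD T U ν f x + (R (fluct η A ν x) (R (U ν x) (f (T ν x))) - R (U ν x) (f (T ν x))) := by
  simp only [covD, prodCfg, B9Eq39Adjoint.R_mul]
  abel

/-- **(3.70)**, exactly, for the covariant curl `(D A′)_{νμ} = D_νA′_μ − D_μA′_ν` (the display after (3.4), p. 391):
`(D¹_{U′U}A′)_{νμ}(x) = (D¹_U A′)_{νμ}(x) + (R(U′_ν(x)) − 1)R(U(x,x+e_ν))A′_μ(x+e_ν) − (R(U′_μ(x)) − 1)R(U(x,x+e_μ))A′_ν(x+e_μ)`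
— the print's display with `exp ηiad_{A_ν(x)}` in the first and (TYPED READING, see the header) `exp ηiad_{A_μ(x)}` in the
second correction term. [folklore] [cite: Balaban1985BackgroundPropagators, (3.70) p.404] -/
theorem curl_prodCfg (η : ℝ) (A A' : ι → S → 𝔸) (ν μ : ι) (x : S) :
    curl T (prodCfg U η A) A' ν μ x
      = curl T U A' ν μ x
        + (R (fluct η A ν x) (R (U ν x) (A' μ (T ν x))) - R (U ν x) (A' μ (T ν x)))
        - (R (fluct η A μ x) (R (U μ x) (A' ν (T μ x))) - R (U μ x) (A' ν (T μ x))) := by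
  simp only [curl, covD_prodCfg]
  abel

/-- **(3.70) EXPANDED TO FIRST ORDER**: `(D¹_{U′U,ν}f)(x) = (D¹_{U,ν}f)(x) + iη[A_ν(x), Y] + 𝓕(iηA_ν(x), Y)`,
`Y = R(U(x,x+e_ν))f(x+e_ν)` — background derivative + the first-order vertex («1 + ηiad_A») + the `F`-remainder of p. 405.
[folklore] [cite: Balaban1985BackgroundPropagators, (3.70) p.404, p.405] -/
theorem covD_prodCfg_expand (η : ℝ) (A : ι → S → 𝔸) (ν : ι) (f : S → 𝔸) (x : S) :
    covD T (prodCfg U η A) ν f x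
      = covD T U ν f x + ad (((I * η : ℂ)) • A ν x) (R (U ν x) (f (T ν x)))
        + conjRem (((I * η : ℂ)) • A ν x) (R (U ν x) (f (T ν x))) := by
  rw [covD_prodCfg, R_fluct, conj_eq_expand]
  abel

omit [CompleteSpace 𝔸] in
/-- `‖iηA‖ = η‖A‖` for `η ≥ 0` (`B12Membership314.norm_I_mul_smul` BY NAME). [folklore] -/
theorem norm_Iη_smul {η : ℝ} (hη : 0 ≤ η) (Y : 𝔸) : ‖((I * η : ℂ)) • Y‖ = η * ‖Y‖ :=
  B12Membership314.norm_I_mul_smul hη Y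

/-- **ZEROTH ORDER IN NORM**: `‖(D¹_{U′U,ν}f)(x) − (D¹_{U,ν}f)(x)‖ ≤ (e^{2η‖A_ν(x)‖} − 1)·‖R(U(x,x+e_ν))f(x+e_ν)‖`
(`≤ 2η‖A_ν(x)‖e^{2η‖A_ν(x)‖}·‖Y‖`: the difference `D_{U′U} − D_U` is `O(|A|)`, as used in (3.76)). [folklore]
[cite: Balaban1985BackgroundPropagators, (3.70) p.404, (3.76) p.405] -/
theorem norm_covD_prodCfg_sub_le {η : ℝ} (hη : 0 ≤ η) (A : ι → S → 𝔸) (ν : ι) (f : S → 𝔸) (x : S) :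
    ‖covD T (prodCfg U η A) ν f x - covD T U ν f x‖
      ≤ (Real.exp (2 * (η * ‖A ν x‖)) - 1) * ‖R (U ν x) (f (T ν x))‖ := by
  rw [covD_prodCfg, add_sub_cancel_left, R_fluct, ← norm_Iη_smul hη (A ν x)]
  exact norm_conj_sub_le _ _

/-- **FIRST-ORDER REMAINDER IN NORM** (the `F_{1,k}`-type term of ONE transport):
`‖(D¹_{U′U,ν}f)(x) − (D¹_{U,ν}f)(x) − iη[A_ν(x), Y]‖ ≤ (e^{2s} − 1 − 2s)‖Y‖ ≤ 2s²e^{2s}‖Y‖`, `s = η‖A_ν(x)‖` — «O(1)|A|²|A′|»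
with `O(1) = 2e^{2s}` and the transport `‖Y‖ ≤ ‖U_ν(x)‖‖f(x+e_ν)‖‖U_ν(x)⁻¹‖` (`norm_R_le`). [folklore]
[cite: Balaban1985BackgroundPropagators, (3.72) p.405] -/
theorem norm_covD_prodCfg_rem_le {η : ℝ} (hη : 0 ≤ η) (A : ι → S → 𝔸) (ν : ι) (f : S → 𝔸) (x : S) :
    ‖covD T (prodCfg U η A) ν f x - covD T U ν f x - ad (((I * η : ℂ)) • A ν x) (R (U ν x) (f (T ν x)))‖
      ≤ 2 * (η * ‖A ν x‖) ^ 2 * Real.exp (2 * (η * ‖A ν x‖)) * ‖R (U ν x) (f (T ν x))‖ := by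
  rw [covD_prodCfg_expand, show ∀ a b c : 𝔸, a + b + c - a - b = c from fun a b c => by abel,
    ← norm_Iη_smul hη (A ν x)]
  exact norm_conjRem_le_sq _ _

omit [CompleteSpace 𝔸] in
/-- The first-order vertex itself is `O(|A||A′|)`: `‖iη[A_ν(x), Y]‖ ≤ 2η‖A_ν(x)‖‖Y‖` (`Beta.BackgroundVertices.norm_ad_le`).
[folklore] -/
theorem norm_vertex_le {η : ℝ} (hη : 0 ≤ η) (A : ι → S → 𝔸) (ν : ι) (Y : 𝔸) (x : S) :
    ‖ad (((I * η : ℂ)) • A ν x) Y‖ ≤ 2 * (η * ‖A ν x‖) * ‖Y‖ := by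
  rw [← norm_Iη_smul hη (A ν x)]
  exact norm_ad_le _ _

/-- **AT THE PRINTED SCALE** ((3.37) at the bond: `‖A_ν(x)‖ ≤ α₁(L^jη)⁻¹`, `L ≥ 1`, `η > 0`, so `s = η‖A_ν(x)‖ ≤ α₁L^{−j} ≤ α₁`):
the one-transport `F`-remainder is `≤ 2e^{2α₁}·α₁²·L^{−2j}·‖Y‖` — i.e. `η·(2e^{2α₁})·α₁²(L^jη)⁻²·‖Y‖` per `D¹ = ηD`, the shape
`O(1)α₁²(L^jη)⁻²|A′|` of (3.72) one power of `η` stronger (the second covariant difference of (3.71) spends it). [folklore]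
[cite: Balaban1985BackgroundPropagators, (3.72) p.405, (3.37) p.396] -/
theorem norm_covD_prodCfg_rem_le_printed {η L α₁ : ℝ} {j : ℕ} (hη : 0 < η) (hL : 1 ≤ L)
    (A : ι → S → 𝔸) (ν : ι) (f : S → 𝔸) (x : S) (hA : ‖A ν x‖ ≤ α₁ * (L ^ j * η)⁻¹) :
    ‖covD T (prodCfg U η A) ν f x - covD T U ν f x - ad (((I * η : ℂ)) • A ν x) (R (U ν x) (f (T ν x)))‖
      ≤ 2 * Real.exp (2 * α₁) * α₁ ^ 2 * ((L ^ j)⁻¹) ^ 2 * ‖R (U ν x) (f (T ν x))‖ := by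
  have hLj : 1 ≤ L ^ j := one_le_pow₀ hL
  have hLj0 : 0 < L ^ j := lt_of_lt_of_le one_pos hLj
  have hs : η * ‖A ν x‖ ≤ α₁ * (L ^ j)⁻¹ := by
    calc η * ‖A ν x‖ ≤ η * (α₁ * (L ^ j * η)⁻¹) := mul_le_mul_of_nonneg_left hA hη.le
      _ = α₁ * (L ^ j)⁻¹ := by field_simp
  have hs0 : 0 ≤ η * ‖A ν x‖ := mul_nonneg hη.le (norm_nonneg _)
  have hα : 0 ≤ α₁ := by
    by_contra hc
    have h1 : α₁ * (L ^ j)⁻¹ < 0 := mul_neg_of_neg_of_pos (lt_of_not_ge hc) (inv_pos.mpr hLj0)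
    linarith
  have hs1 : η * ‖A ν x‖ ≤ α₁ := hs.trans (mul_le_of_le_one_right hα (inv_le_one_of_one_le₀ hLj))
  refine (norm_covD_prodCfg_rem_le T U hη.le A ν f x).trans ?_
  have hY := norm_nonneg (R (U ν x) (f (T ν x)))
  have hE : Real.exp (2 * (η * ‖A ν x‖)) ≤ Real.exp (2 * α₁) := Real.exp_le_exp.mpr (by linarith)
  have hsq : (η * ‖A ν x‖) ^ 2 ≤ α₁ ^ 2 * ((L ^ j)⁻¹) ^ 2 := by
    rw [← mul_pow]; exact pow_le_pow_left₀ hs0 hs 2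
  calc 2 * (η * ‖A ν x‖) ^ 2 * Real.exp (2 * (η * ‖A ν x‖)) * ‖R (U ν x) (f (T ν x))‖
      ≤ 2 * (α₁ ^ 2 * ((L ^ j)⁻¹) ^ 2) * Real.exp (2 * α₁) * ‖R (U ν x) (f (T ν x))‖ := by
        gcongr
    _ = 2 * Real.exp (2 * α₁) * α₁ ^ 2 * ((L ^ j)⁻¹) ^ 2 * ‖R (U ν x) (f (T ν x))‖ := by ring

end Eq370

/-! ## §3  (3.74): the adjoint covariant derivative of the product configuration -/

section Eq374

variable {𝔸 : Type*} [NormedRing 𝔸] [NormedAlgebra ℂ 𝔸] [CompleteSpace 𝔸] {S : Type*} {ι : Type*}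
variable (T : ι → Equiv.Perm S) (U : ι → S → 𝔸ˣ)

/-- The reversed product bond: `R((U′U)(x, x−e_ν))Z = R(U(x, x−e_ν))(e^{−iηA_ν(x−e_ν)}·Z·e^{iηA_ν(x−e_ν)})`
(`(U′U)(x, x−e_ν) = ((U′U)(x−e_ν, x))⁻¹ = U(x−e_ν, x)⁻¹e^{−iηA_ν(x−e_ν)}` by (3.5)). [folklore]
[cite: Balaban1985BackgroundPropagators, (3.5) p.391, (3.74) p.405] -/
theorem R_inv_prodCfg (η : ℝ) (A : ι → S → 𝔸) (ν : ι) (y : S) (Z : 𝔸) :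
    R (prodCfg U η A ν y)⁻¹ Z
      = R (U ν y)⁻¹ (exp (-(((I * η : ℂ)) • A ν y)) * Z * exp (((I * η : ℂ)) • A ν y)) := by
  have h : (prodCfg U η A ν y)⁻¹ = (U ν y)⁻¹ * (fluct η A ν y)⁻¹ := by
    simp only [prodCfg, mul_inv_rev]
  rw [h, B9Eq39Adjoint.R_mul, R_def (fluct η A ν y)⁻¹, inv_inv, val_inv_fluct, val_fluct]

/-- **(3.74) FOR ONE DIRECTION**, exactly: with `y = x − e_ν`, `a′ = R(U(x, x−e_ν))A_ν(x−e_ν)`, `W = R(U(x, x−e_ν))G(x−e_ν)`,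
`(D¹*_{U′U,ν}G)(x) = (D¹*_{U,ν}G)(x) + (e^{−iηa′}·W·e^{iηa′} − W)` — the print's
`η⁻¹[exp(−ηiad_{R(U(x,x−ηe_ν))A_ν(x−ηe_ν)}) − 1]·R(U(x, x−ηe_ν))A′_ν(x−ηe_ν)` at `η`-free normalisation; the transport of the
conjugation through `R(U(x, x−e_ν))` is `R_conj_exp`. [folklore] [cite: Balaban1985BackgroundPropagators, (3.74) p.405] -/
theorem covDstar_prodCfg (η : ℝ) (A : ι → S → 𝔸) (ν : ι) (G : S → 𝔸) (x : S) :
    covDstar T (prodCfg U η A) ν G x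
      = covDstar T U ν G x
        + (exp (-(R (U ν ((T ν).symm x))⁻¹ (((I * η : ℂ)) • A ν ((T ν).symm x))))
            * R (U ν ((T ν).symm x))⁻¹ (G ((T ν).symm x))
            * exp (R (U ν ((T ν).symm x))⁻¹ (((I * η : ℂ)) • A ν ((T ν).symm x)))
          - R (U ν ((T ν).symm x))⁻¹ (G ((T ν).symm x))) := by
  simp only [covDstar, R_inv_prodCfg, R_conj_exp]
  abel

omit [CompleteSpace 𝔸] in
/-- `R(V)(iηA) = iη·R(V)A` (`B9Eq39Adjoint.R_smul`): the transported letter `a′` carries the same `iη`. [folklore] -/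
theorem R_Iη_smul (V : 𝔸ˣ) (η : ℝ) (X : 𝔸) : R V (((I * η : ℂ)) • X) = ((I * η : ℂ)) • R V X :=
  R_smul V _ X

/-- **(3.74) FOR `D* = Σ_ν D*_ν` ON BOND FUNCTIONS** (`B9Eq39Adjoint.divB`), exactly:
`(D¹*_{U′U}A′)(x) = (D¹*_U A′)(x) + Σ_ν (e^{−iηa′_ν}·W_ν·e^{iηa′_ν} − W_ν)`, `a′_ν = R(U(x,x−e_ν))A_ν(x−e_ν)`,
`W_ν = R(U(x,x−e_ν))A′_ν(x−e_ν)`. [folklore] [cite: Balaban1985BackgroundPropagators, (3.74) p.405] -/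
theorem divB_prodCfg [Fintype ι] (η : ℝ) (A A' : ι → S → 𝔸) (x : S) :
    divB T (prodCfg U η A) A' x
      = divB T U A' x
        + ∑ ν, (exp (-(R (U ν ((T ν).symm x))⁻¹ (((I * η : ℂ)) • A ν ((T ν).symm x))))
            * R (U ν ((T ν).symm x))⁻¹ (A' ν ((T ν).symm x))
            * exp (R (U ν ((T ν).symm x))⁻¹ (((I * η : ℂ)) • A ν ((T ν).symm x)))
          - R (U ν ((T ν).symm x))⁻¹ (A' ν ((T ν).symm x))) := by
  simp only [divB, covDstar_prodCfg, Finset.sum_add_distrib]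

/-- **ZEROTH ORDER IN NORM for (3.74)**: `‖(D¹*_{U′U,ν}G)(x) − (D¹*_{U,ν}G)(x)‖ ≤ (e^{2η‖a′‖} − 1)‖W‖` with
`‖a′‖ ≤ ‖U_ν(y)⁻¹‖‖A_ν(y)‖‖U_ν(y)‖` (`norm_R_le`; `= ‖A_ν(y)‖` for a unitary background in an operator norm). [folklore]
[cite: Balaban1985BackgroundPropagators, (3.74) p.405] -/
theorem norm_covDstar_prodCfg_sub_le {η : ℝ} (hη : 0 ≤ η) (A : ι → S → 𝔸) (ν : ι) (G : S → 𝔸) (x : S) :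
    ‖covDstar T (prodCfg U η A) ν G x - covDstar T U ν G x‖
      ≤ (Real.exp (2 * (η * ‖R (U ν ((T ν).symm x))⁻¹ (A ν ((T ν).symm x))‖)) - 1)
          * ‖R (U ν ((T ν).symm x))⁻¹ (G ((T ν).symm x))‖ := by
  rw [covDstar_prodCfg, add_sub_cancel_left, R_Iη_smul, ← norm_Iη_smul hη (R (U ν ((T ν).symm x))⁻¹ _)]
  have h := norm_conj_sub_le (-(((I * η : ℂ)) • R (U ν ((T ν).symm x))⁻¹ (A ν ((T ν).symm x))))
    (R (U ν ((T ν).symm x))⁻¹ (G ((T ν).symm x)))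
  rwa [neg_neg, norm_neg] at h

/-- **FIRST ORDER for (3.74)**: `(D¹*_{U′U,ν}G)(x) = (D¹*_{U,ν}G)(x) − iη[a′, W] + 𝓕(−iηa′, W)` with
`‖𝓕(−iηa′, W)‖ ≤ 2(η‖a′‖)²e^{2η‖a′‖}‖W‖` — the print's `exp(−ηiad_{a′}) = 1 − ηiad_{a′} + ⋯` and its remainder. [folklore]
[cite: Balaban1985BackgroundPropagators, (3.74) p.405, (3.72) p.405] -/
theorem covDstar_prodCfg_expand (η : ℝ) (A : ι → S → 𝔸) (ν : ι) (G : S → 𝔸) (x : S) :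
    covDstar T (prodCfg U η A) ν G x
      = covDstar T U ν G x
        - ad (((I * η : ℂ)) • R (U ν ((T ν).symm x))⁻¹ (A ν ((T ν).symm x))) (R (U ν ((T ν).symm x))⁻¹ (G ((T ν).symm x)))
        + conjRem (-(((I * η : ℂ)) • R (U ν ((T ν).symm x))⁻¹ (A ν ((T ν).symm x))))
            (R (U ν ((T ν).symm x))⁻¹ (G ((T ν).symm x))) := by
  rw [covDstar_prodCfg, R_Iη_smul]
  have h := conj_eq_expand (-(((I * η : ℂ)) • R (U ν ((T ν).symm x))⁻¹ (A ν ((T ν).symm x))))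
    (R (U ν ((T ν).symm x))⁻¹ (G ((T ν).symm x)))
  rw [neg_neg] at h
  rw [h, Beta.BackgroundVertices.ad_neg_left]
  abel

/-- … and its remainder bound. [folklore] [cite: Balaban1985BackgroundPropagators, (3.72) p.405] -/
theorem norm_covDstar_prodCfg_rem_le {η : ℝ} (hη : 0 ≤ η) (A : ι → S → 𝔸) (ν : ι) (G : S → 𝔸) (x : S) :
    ‖covDstar T (prodCfg U η A) ν G x - covDstar T U ν G x
        + ad (((I * η : ℂ)) • R (U ν ((T ν).symm x))⁻¹ (A ν ((T ν).symm x))) (R (U ν ((T ν).symm x))⁻¹ (G ((T ν).symm x)))‖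
      ≤ 2 * (η * ‖R (U ν ((T ν).symm x))⁻¹ (A ν ((T ν).symm x))‖) ^ 2
          * Real.exp (2 * (η * ‖R (U ν ((T ν).symm x))⁻¹ (A ν ((T ν).symm x))‖))
          * ‖R (U ν ((T ν).symm x))⁻¹ (G ((T ν).symm x))‖ := by
  rw [covDstar_prodCfg_expand, show ∀ a b c : 𝔸, a - b + c - a + b = c from fun a b c => by abel]
  have h := norm_conjRem_le_sq (-(((I * η : ℂ)) • R (U ν ((T ν).symm x))⁻¹ (A ν ((T ν).symm x))))
    (R (U ν ((T ν).symm x))⁻¹ (G ((T ν).symm x)))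
  rwa [norm_neg, norm_Iη_smul hη] at h

end Eq374

/-! ## §4  Sanity -/

section Examples

variable {𝔸 : Type*} [NormedRing 𝔸] [NormedAlgebra ℂ 𝔸] [CompleteSpace 𝔸] {S : Type*} {ι : Type*}
variable (T : ι → Equiv.Perm S) (U : ι → S → 𝔸ˣ)

/-- No fluctuation field, no correction: `A = 0` gives `D_{U′U} = D_U` ((3.70) with `U′ = 1`). [folklore] -/
example (η : ℝ) (ν : ι) (f : S → 𝔸) (x : S) :
    covD T (prodCfg U η (0 : ι → S → 𝔸)) ν f x = covD T U ν f x := by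
  rw [prodCfg_zero]

/-- The remainder functional vanishes to second order at `b = 0`: `𝓕(0, X) = 0`. [folklore] -/
example (X : 𝔸) : conjRem (0 : 𝔸) X = 0 := by
  simp [conjRem, ad]

/-- In a commutative world the whole correction is zero: if `b` commutes with `X` then `e^{b}Xe^{−b} = X`
(so (3.70)'s correction terms are genuinely non-abelian). [folklore] -/
example (b X : 𝔸) (h : Commute b X) : exp b * X * exp (-b) = X := by
  have hc : Commute (exp b) X := (h.symm.exp_right).symm
  rw [hc.eq, mul_assoc, ← Beta.BackgroundVertices.val_expUnit ℂ b, ← Beta.BackgroundVertices.val_inv_expUnit ℂ b,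
    Units.mul_inv, mul_one]

end Examples

end Literature.MathematicalPhysics.QuantumFieldTheory.Balaban1983to89.B9Eq370Expansion
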